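import Literature.MathematicalPhysics.QuantumFieldTheory.StrongCouplingReplica
import HarnessLib

/-!
# Crux `NT` (stmt-QuantumFields-19353), strong-coupling rungs: the TEMPORAL TUBE OF ANY LENGTH — definitions

Definition file of the fleet lead prover of crux `NT` (unit `ym-spine-19353-p1`, g27).  The leading strong-coupling
diagram of the plaquette–plaquette covariance at time separation `n` is the boundary of the `n × 1 × 1` box
`[z₀, z₀ + n]₀ × [0,1]_{a₁} × [0,1]_{a₂}`: two CAPS (the non-temporal plaquettes `(z; a)` and `(z + n e₀; a)`,
`a = (a₁, a₂)`, `0 < a₁ < a₂`) and `4n` temporal SIDES (four over the unit square at each level `z + k e₀`, `k < n`).  The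
tree lists these tubes LITERALLY for `n = 2` (`MirrorJet`, ten faces) and `n = 4` (`…HigherMirrorTubes`, eighteen faces);
this file names them for every `n`, so that the classification / sphere property / Haar constant / free pair jet are
proved ONCE for all separations (the all-anchor strong-coupling rungs behind LINE φ rev 7,
`Cruxes/NT/Lines/slab_response_birth.lean`, whose IR-anchored stubs sit at mirror separation `2s`, every `s ≥ 1`):

* `tubeSides y a ha` — the four temporal sides over the square `(y; a)`: `(y; 0,a₁)`, `(y + e_{a₂}; 0,a₁)`, `(y; 0,a₂)`,
  `(y + e_{a₁}; 0,a₂)` (the order of `ClosedFamilies.eq_longTube_of_closed` / `MirrorClass.mem_sides_of_far_mem`);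
* `openTube z n a ha` — the tube WITHOUT its bottom cap: the sides at the levels `z + k e₀`, `k < n`, and the top cap
  `(z + n e₀; a)`; recursion `openTube z (n+1) = tubeSides z ∪ openTube (z + e₀) n` (`openTube_succ`), the shape the
  ring transfer `…LongTubeRing.ring_transfer` iterates on;
* `longTube z n a ha = insert (z; a) (openTube z n a ha)` — the closed tube (`4n + 2` faces for `n ≥ 1`);
* `tubeCorners z n a` — the `4(n+1)` sites `z + k e₀ + c`, `k ≤ n`, `c ∈ {0, e_{a₁}, e_{a₂}, e_{a₁} + e_{a₂}}` (all face
  corners; the smallest region on which the free jet is read);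
* `longTubes z n` — the three tubes over the spatial squares `a ∈ {(1,2), (1,3), (2,3)}`; `longTubeRegion z n` — the union
  of their corner sets;
* `mem_tubeSides`, `mem_openTube`, `mem_longTube`, `openTube_zero`, `openTube_succ`, `mem_tubeCorners`, `mem_longTubes`,
  `mem_longTubeRegion` — the unfoldings.

HONEST FRAMING: lattice bookkeeping only (definitions); nothing about measures, `β`, NT or the gap. [folklore]
-/

namespace Summit.QuantumFields.YangMills.Cruxes.NT.StrongCouplingRung.LongTube

open Finset
open Literature.Probability.LatticeModels (Site)
open Literature.MathematicalPhysics.QuantumLattice (ZdEdge ZdPlaquette plaquetteEdges)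

/-- **The four temporal sides over the unit square `(y; a)`**, `a = (a₁, a₂)` with `0 < a₁ < a₂`: the temporal
plaquettes `(y; 0,a₁)`, `(y + e_{a₂}; 0,a₁)`, `(y; 0,a₂)`, `(y + e_{a₁}; 0,a₂)`. [folklore] -/
def tubeSides (y : Site 4) (a : {q : Fin 4 × Fin 4 // q.1 < q.2}) (ha : (0 : Fin 4) < a.1.1) :
    Finset (ZdPlaquette 4) :=
  {(y, ⟨(0, a.1.1), ha⟩), (y + Pi.single a.1.2 1, ⟨(0, a.1.1), ha⟩), (y, ⟨(0, a.1.2), ha.trans a.2⟩),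
    (y + Pi.single a.1.1 1, ⟨(0, a.1.2), ha.trans a.2⟩)}

/-- **The open tube of length `n` over `(z; a)`** (no bottom cap): the sides at the levels `z + k e₀`, `k < n`, and the
top cap `(z + n e₀; a)`. [folklore] -/
def openTube (z : Site 4) (n : ℕ) (a : {q : Fin 4 × Fin 4 // q.1 < q.2}) (ha : (0 : Fin 4) < a.1.1) :
    Finset (ZdPlaquette 4) :=
  insert (z + Pi.single 0 (n : ℤ), a) ((range n).biUnion fun k => tubeSides (z + Pi.single 0 (k : ℤ)) a ha)

/-- **The temporal tube of length `n` over the square `(z; a)`** — the boundary of the box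
`[z₀, z₀ + n]₀ × [0,1]_{a₁} × [0,1]_{a₂}` (at the remaining coordinate of `z`): the bottom cap `(z; a)`, the top cap
`(z + n e₀; a)` and the `4n` temporal sides at the levels `z + k e₀`, `k < n`. [folklore] -/
def longTube (z : Site 4) (n : ℕ) (a : {q : Fin 4 × Fin 4 // q.1 < q.2}) (ha : (0 : Fin 4) < a.1.1) :
    Finset (ZdPlaquette 4) :=
  insert (z, a) (openTube z n a ha)

/-- **The corners of the tube of length `n` over `(z; a)`**: the sites `z + k e₀ + c`, `k ≤ n`,
`c ∈ {0, e_{a₁}, e_{a₂}, e_{a₁} + e_{a₂}}`. [folklore] -/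
def tubeCorners (z : Site 4) (n : ℕ) (a : {q : Fin 4 × Fin 4 // q.1 < q.2}) : Finset (Site 4) :=
  (range (n + 1)).biUnion fun k =>
    {z + Pi.single 0 (k : ℤ), z + Pi.single 0 (k : ℤ) + Pi.single a.1.1 1, z + Pi.single 0 (k : ℤ) + Pi.single a.1.2 1,
      z + Pi.single 0 (k : ℤ) + Pi.single a.1.1 1 + Pi.single a.1.2 1}

/-- **The three temporal tubes of length `n` based at `z`**, over the spatial squares `(1,2)`, `(1,3)`, `(2,3)` — the
minimal closed joined plaquette families through a plaquette based at `z + n e₀` and one based at `z`. [folklore] -/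
def longTubes (z : Site 4) (n : ℕ) : Finset (Finset (ZdPlaquette 4)) :=
  {longTube z n ⟨(1, 2), by decide⟩ (by decide), longTube z n ⟨(1, 3), by decide⟩ (by decide),
    longTube z n ⟨(2, 3), by decide⟩ (by decide)}

/-- The corners of the three tubes of length `n` based at `z` (`7(n+1)` sites). [folklore] -/
def longTubeRegion (z : Site 4) (n : ℕ) : Finset (Site 4) :=
  tubeCorners z n ⟨(1, 2), by decide⟩ ∪ tubeCorners z n ⟨(1, 3), by decide⟩ ∪ tubeCorners z n ⟨(2, 3), by decide⟩

/-! ### Unfoldings -/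

/-- Membership in the four sides. [folklore] -/
theorem mem_tubeSides {y : Site 4} {a : {q : Fin 4 × Fin 4 // q.1 < q.2}} {ha : (0 : Fin 4) < a.1.1}
    {p : ZdPlaquette 4} :
    p ∈ tubeSides y a ha ↔ p = (y, ⟨(0, a.1.1), ha⟩) ∨ p = (y + Pi.single a.1.2 1, ⟨(0, a.1.1), ha⟩) ∨
      p = (y, ⟨(0, a.1.2), ha.trans a.2⟩) ∨ p = (y + Pi.single a.1.1 1, ⟨(0, a.1.2), ha.trans a.2⟩) := by
  simp only [tubeSides, mem_insert, mem_singleton]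

/-- Membership in the open tube: the top cap or a side at a level `k < n`. [folklore] -/
theorem mem_openTube {z : Site 4} {n : ℕ} {a : {q : Fin 4 × Fin 4 // q.1 < q.2}} {ha : (0 : Fin 4) < a.1.1}
    {p : ZdPlaquette 4} :
    p ∈ openTube z n a ha ↔ p = (z + Pi.single 0 (n : ℤ), a) ∨
      ∃ k, k < n ∧ p ∈ tubeSides (z + Pi.single 0 (k : ℤ)) a ha := by
  simp only [openTube, mem_insert, mem_biUnion, mem_range]

/-- Membership in the tube: bottom cap, top cap, or a side at a level `k < n`. [folklore] -/
theorem mem_longTube {z : Site 4} {n : ℕ} {a : {q : Fin 4 × Fin 4 // q.1 < q.2}} {ha : (0 : Fin 4) < a.1.1}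
    {p : ZdPlaquette 4} :
    p ∈ longTube z n a ha ↔ p = (z, a) ∨ p = (z + Pi.single 0 (n : ℤ), a) ∨
      ∃ k, k < n ∧ p ∈ tubeSides (z + Pi.single 0 (k : ℤ)) a ha := by
  simp only [longTube, mem_insert, mem_openTube]

/-- The open tube of length `0` is the (top = bottom) cap alone. [folklore] -/
theorem openTube_zero (z : Site 4) (a : {q : Fin 4 × Fin 4 // q.1 < q.2}) (ha : (0 : Fin 4) < a.1.1) :
    openTube z 0 a ha = {(z, a)} := by
  ext p
  simp [mem_openTube]

/-- **Recursion of the open tube**: `openTube z (n+1) = tubeSides z ∪ openTube (z + e₀) n` — the four sides at the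
bottom level, then the open tube one level up. [folklore] -/
theorem openTube_succ (z : Site 4) (n : ℕ) (a : {q : Fin 4 × Fin 4 // q.1 < q.2}) (ha : (0 : Fin 4) < a.1.1) :
    openTube z (n + 1) a ha = tubeSides z a ha ∪ openTube (z + Pi.single 0 1) n a ha := by
  ext p
  simp only [mem_openTube, mem_union]
  have hz : ∀ k : ℕ, z + Pi.single 0 1 + Pi.single 0 (k : ℤ) = z + Pi.single (0 : Fin 4) ((k + 1 : ℕ) : ℤ) := by
    intro k
    rw [add_assoc, ← Pi.single_add]
    congr 2
    push_cast
    ring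
  constructor
  · rintro (h | ⟨k, hk, hp⟩)
    · refine Or.inr (Or.inl ?_)
      rw [h, hz]
    · rcases k with _ | k
      · left
        simpa using hp
      · exact Or.inr (Or.inr ⟨k, by omega, by rw [hz]; exact hp⟩)
  · rintro (hp | h | ⟨k, hk, hp⟩)
    · exact Or.inr ⟨0, by omega, by simpa using hp⟩
    · left
      rw [h, hz]
    · exact Or.inr ⟨k + 1, by omega, by rw [← hz]; exact hp⟩

/-- Membership in the corner region. [folklore] -/
theorem mem_tubeCorners {z : Site 4} {n : ℕ} {a : {q : Fin 4 × Fin 4 // q.1 < q.2}} {x : Site 4} :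
    x ∈ tubeCorners z n a ↔ ∃ k, k < n + 1 ∧ (x = z + Pi.single 0 (k : ℤ) ∨
      x = z + Pi.single 0 (k : ℤ) + Pi.single a.1.1 1 ∨ x = z + Pi.single 0 (k : ℤ) + Pi.single a.1.2 1 ∨
      x = z + Pi.single 0 (k : ℤ) + Pi.single a.1.1 1 + Pi.single a.1.2 1) := by
  simp only [tubeCorners, mem_biUnion, mem_range, mem_insert, mem_singleton]

/-- Membership in the list of the three tubes. [folklore] -/
theorem mem_longTubes {z : Site 4} {n : ℕ} {T : Finset (ZdPlaquette 4)} :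
    T ∈ longTubes z n ↔ T = longTube z n ⟨(1, 2), by decide⟩ (by decide) ∨
      T = longTube z n ⟨(1, 3), by decide⟩ (by decide) ∨ T = longTube z n ⟨(2, 3), by decide⟩ (by decide) := by
  simp only [longTubes, mem_insert, mem_singleton]

/-- Membership in the region of the three tubes. [folklore] -/
theorem mem_longTubeRegion {z : Site 4} {n : ℕ} {x : Site 4} :
    x ∈ longTubeRegion z n ↔ x ∈ tubeCorners z n ⟨(1, 2), by decide⟩ ∨ x ∈ tubeCorners z n ⟨(1, 3), by decide⟩ ∨
      x ∈ tubeCorners z n ⟨(2, 3), by decide⟩ := by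
  simp only [longTubeRegion, mem_union, or_assoc]

end Summit.QuantumFields.YangMills.Cruxes.NT.StrongCouplingRung.LongTube
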